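import Mathlib
import HarnessLib
import Summits.NavierStokesRegularity.NavierStokesRegularity.Theses.SymmetryModuliCount
import Literature.Analysis.FluidPDE.LocalTypeI

/-!
# Line `far-past-energy-ledger` — crux `SymmetryModuliCount.ForcedSymmetry` (stmt-NavierStokesRegularity-4052)

Skeleton of the proving line built from the crux idea card
`Cruxes/ForcedSymmetry/Ideas/far-past-energy-ledger.md` (triage r1-1/2/3: pass ×3; merged with
`superparabolic-energy-sparseness`; "plan as ONE line with blow-down-census"), planner
`planner-cruxplan-stmt-NavierStokesRegularity-4052-far-past-energy-ledg-0`, 2026-08-16. Line card: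
`Cruxes/ForcedSymmetry/Lines/far-past-energy-ledger.md`.

## Shape

By the panel finding of the three triage notes (`TRIAGE-r1-1..3.md`: backward-shift VertexLemma +
Killing leaves) the crux `ForcedSymmetry` is equivalent to the route target X = `TypeIAncientLiouville`
(stmt-4050); `X → ForcedSymmetry` is kernel-checked (`Disproof.lean §4`,
`forcedSymmetry_of_typeIAncientLiouville`; re-proved here as `hasSimSymmetry_of_vanishes`, six lines).
So every concluding line for 4052 is a line for X, and this file goes through X explicitly
(`typeIAncientLiouville_of`).

THE LEVER (card): run the local energy balance of `u ∈ A_C` on `B_R(x₀)` from the FAR PAST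
`s = −4R²`, where the Type-I ceiling makes the deposit `O(C²R)`; with the KNSS near/far pressure
structure (`stub_knssPressure`, known: KNSS 2009 §2) a three-step bootstrap of the exponent closes at
LERAY'S RATE `∫_{B_R(x₀)} |u(t)|² ≤ K R` for all `t < 0`, all centres, all radii — equivalently the
scale-invariant local energies `A, E ≤ K(C)` on EVERY backward cylinder including those with top on the
final time: `A_C ⊂ 𝒦_{K(C)}` (`stub_farPastLedger`, the card's NEW lemma; Albritton–Barker 2019
Remark 3.2 records the implication "temporal Type I ⇒ 𝐈 < ∞" as not known).  WHAT IT BUYS: inside 𝒦 the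
blow-down `k u(t₀ + k²t, x₀ + kx)`, `k → ∞`, at a point where `u(t₀,x₀) ≠ 0` has limits which stay in
`A_C ∩ 𝒦` and are SINGULAR at the space–time origin (Lin compactness + Rusin–Šverák persistence =
Albritton–Barker Lemma 2.2 / Prop. 2.3, tree theorems `SuitableCompactness_holds`,
`PersistenceOfSingularities_holds`; `stub_blowDownClosure`) — a renormalisation of `A_C ∖ {0}` that
can never reach `0`.  THE OPEN CORE, in the form this toolbox makes attackable
(`stub_asymptoticSpiralSelfSimilarity`, hardest): some blow-down limit is SPIRAL-SELF-SIMILAR about the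
origin, `L_(0,1,A) U = x·∇U + (Ax)·∇U + U + 2t∂ₜU − AU ≡ 0` — the Navier–Stokes analogue of
"Type-I ⇒ self-similar tangent flow" (Giga–Kohn 1985 semilinear heat; Huisken 1990 MCF;
Enders–Müller–Topping 2011 Ricci), whose known proofs all run through a scale-critical MONOTONE
functional; the ledger is what makes the natural candidates finite on `A_C` (all scale-critical local
energies bounded on all balls).  THE LEAVES: a self-similar element of `A_C` vanishes
(`stub_selfSimilarLeafVanishes`, KNOWN: Euler homogeneity ⇒ bounded Leray profile ⇒ constant by
Tsai 1998 Thm 1 `q = ∞` = tree theorem `tsai_selfsimilar_bounded_holds` ⇒ `0` by the Oseen gauge,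
`IsTypeIAncientMild.eq_zero_of_slice_const`); a ROTATED self-similar element of `A_C ∩ 𝒦` vanishes
(`stub_rotatedSelfSimilarLeafVanishesInK`, OPEN: the RSS leaf of the sister crux `SymmetricLiouville`
weakened by the ledger's Leray-rate profile decay; Pineau–Vicol 2026 Thm 1.4 covers decaying profiles
with `|α| ≪ 1` or `≫ 1` only).  Composition (sorry-free): nonzero `u` ⇒ blow-down at a nonzero point ⇒
spiral-self-similar limit `U ∈ A_C ∩ 𝒦` singular at `(0,0)` ⇒ `U ≡ 0` by the leaves ⇒ not singular:
contradiction; hence X (`typeIAncientLiouville_of`), hence the crux (`composition`, `ForcedSymmetry_of`).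

Stub signatures are written over tree declarations only (the class `A_C` expanded verbatim from the
route file; the local-energy clause is verbatim clause H5 of the sister crux `SqueezeCycle.MustSqueeze`),
so that a Theorems file can restate and prove each stub by name + signature without importing this
module; the `def`s `InClassA`, `LocalEnergyBound`, `NearFarPressure`, … are definitionally equal
readable aliases used by the composition theorems.

Disproof used (`Cruxes/ForcedSymmetry/Disproof.lean`, cdisprove v3, read 2026-08-16): honours
`forcedSymmetry_false_without_H3` — H3 (the Oseen identity) is used at `stub_knssPressure` (the
pressure IS `RᵢRⱼ(uᵢuⱼ)` mod constants: the drop-H3 witness `w = e^{t/2}e^{−|x|²}(rot x + x₀ rot0 x)`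
solves nothing and has no such pressure) and at `stub_selfSimilarLeafVanishes` (slice-constant mild
fields vanish); honours `not_forcedSymmetryOnDriftClass` and the negatives index entry stmt-4055 (no
stub quantifies over a drift class: every stub keeps H3 ∧ H4); uses §4
`forcedSymmetry_of_typeIAncientLiouville` as the last step (re-proved locally); consistent with §2/§5
(`C ≤ 0` and `C ≤ ε`: `A_C = {0}`, every stub trivially true there).  No `-- Targets` stub kill and no
landed `Theorems/ForcedSymmetry/Negative/` lemma exists (checked `ledger crux ls`, 2026-08-16).
-/

set_option linter.dupNamespace false

namespace Summit.NavierStokesRegularity.NavierStokesRegularity.Cruxes.ForcedSymmetry.FarPastEnergyLedger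

open Filter Topology MeasureTheory

local notation "ℝ³" => EuclideanSpace ℝ (Fin 3)

/-! ## The class and the statements (readable aliases; definitionally the stub signatures below) -/

/-- The route's class `A_C`, verbatim: smooth on `t < 0`, divergence free, KNSS-mild (Oseen-kernel
integral equation between any two negative times), Type-I decay in time `‖u(t,x)‖ ≤ C/√(−t)`. -/
def InClassA (C : ℝ) (u : ℝ → ℝ³ → ℝ³) : Prop :=
  ContDiffOn ℝ (⊤ : ℕ∞) (Function.uncurry u) (Set.Iio 0 ×ˢ Set.univ) ∧ (∀ t < 0,
  Literature.Analysis.FluidPDE.VectorCalculus.IsDivFree (u t)) ∧ (∀ s t : ℝ, s < t → t < 0 → ∀ x, u t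
  x = Literature.Analysis.FluidPDE.heatFlow (u s) (t - s) x - ∫ τ in Set.Ioo s t, ∫ y,
  Literature.Analysis.FluidPDE.oseenKernel (t - τ) (x - y) (u τ y) (u τ y)) ∧
  Literature.Analysis.FluidPDE.HasTypeITimeDecay C u

/-- The local-energy clause `𝒦_K` (verbatim clause H5 of `SqueezeCycle.MustSqueeze`; Albritton–Barker's
`A(Q_r) ≤ K`, `E(Q_r) ≤ K` on EVERY backward cylinder `Q_r(t₀,x₀)` with top `t₀ ≤ 0`, including the
final time). It contains the LERAY RATE `∫_{B_r(x₀)} ‖u(t)‖² ≤ K r` for all `t < 0`, `x₀`, `r`. -/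
def LocalEnergyBound (K : ℝ) (u : ℝ → ℝ³ → ℝ³) : Prop :=
  ∀ (x₀ : ℝ³) (t₀ r : ℝ), t₀ ≤ 0 → 0 < r → (∀ t, t₀ - r ^ 2 < t → t < t₀ → r⁻¹ * ∫ x in
  Metric.ball x₀ r, ‖u t x‖ ^ 2 ≤ K) ∧ r⁻¹ * ∫ t in Set.Ioo (t₀ - r ^ 2) t₀, ∫ x in Metric.ball x₀
  r, ‖fderiv ℝ (u t) x‖ ^ 2 ≤ K

/-- The KNSS NEAR/FAR PRESSURE STRUCTURE with absolute constant `c₀` (KNSS 2009 §2, (2.4)–(2.8): the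
pressure of a bounded mild solution is `RᵢRⱼ(uᵢuⱼ)` modulo constants): on every ball `B_{2R}(x₀)` and
at every time `t < 0`, `p(t) = c + p₁ + p₂` with a NEAR part `p₁ = RR(u⊗u·1_{B_{4R}}) ∈ L²(ℝ³)`,
`‖p₁‖₂² ≤ c₀ ‖u(t)‖²_∞ ‖u(t)‖²_{L²(B_{4R})} ≤ c₀ (C²/(−t)) ∫_{B_{4R}} ‖u‖²` (Plancherel), and a FAR part
`p₂` harmonic on `B_{4R}` with the kernel bound `‖∇p₂(x)‖ ≤ c₀ ∫_{|y−x₀| ≥ 4R} ‖u(t,y)‖² |y−x₀|⁻⁴ dy`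
for `x ∈ B_{2R}(x₀)`. Exactly what the ledger consumes (no gradient bounds on `u` are needed). -/
def NearFarPressure (c₀ C : ℝ) (u : ℝ → ℝ³ → ℝ³) (p : ℝ → ℝ³ → ℝ) : Prop :=
  ∀ t < 0, ∀ (x₀ : ℝ³) (R : ℝ), 0 < R → ∃ (c : ℝ) (p₁ p₂ : ℝ³ → ℝ), (∀ x ∈ Metric.ball x₀ (2 *
  R), p t x = c + p₁ x + p₂ x) ∧ MeasureTheory.MemLp p₁ 2 MeasureTheory.volume ∧ (∫ x, p₁ x ^ 2) ≤
  c₀ * (C ^ 2 / (-t)) * ∫ x in Metric.ball x₀ (4 * R), ‖u t x‖ ^ 2 ∧ (∀ x ∈ Metric.ball x₀ (2 *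
  R), DifferentiableAt ℝ p₂ x ∧ ‖fderiv ℝ p₂ x‖ ≤ c₀ * ∫ y in (Metric.ball x₀ (4 * R))ᶜ, ‖u t y‖ ^
  2 / ‖y - x₀‖ ^ 4)

/-- S1 — the KNSS pressure (known type, size L: singular integrals): every `u ∈ A_C` carries a pressure
`p` making `(u,p)` a classical Navier–Stokes pair on `t < 0` with the near/far structure, for one
absolute constant `c₀`. KNSS 2009 §2; Seregin 2014 Notes §6.3 / Prop. 3.9; tree
`IsTypeIAncientMild.exists_isClassicalNSSolutionOn_Ioo` (classical pressure on each `(t₀,0)`),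
`Literature/Analysis/SingularIntegrals/CalderonZygmund*` and the pattern of `nrs1996_rieszPressure`. -/
def KNSSPressure : Prop :=
  ∃ c₀ : ℝ, ∀ (C : ℝ) (u : ℝ → ℝ³ → ℝ³), InClassA C u → ∃ p : ℝ → ℝ³ → ℝ,
    Literature.Analysis.FluidPDE.IsClassicalNSSolutionOn (Set.Iio 0) 1 0 u p ∧ NearFarPressure c₀ C u p

/-- S2 — THE FAR-PAST ENERGY LEDGER (the card's lemma; NEW as far as the ideator and the three triagers
searched — it answers Albritton–Barker 2019 Remark 3.2 positively for ancient solutions): temporal Type I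
+ Oseen gauge ⇒ the scale-invariant local energies are bounded on every backward cylinder up to and
including the final time, `A_C ⊂ 𝒦_{K(C,c₀)}`. Local energy balance from `s = −4R²` (deposit
`(4π/3)C²R`), fluxes `|u|²|Δφ|`, `|u|³|∇φ|`, `|p−c||u||∇φ|`, bootstrap of the exponent
`a ↦ max(1, a−1)` through the near/far pressure split: `3 → 2 → 1·log² → 1`. Size M–L. -/
def FarPastLedger : Prop :=
  ∀ (C c₀ : ℝ), ∃ K : ℝ, ∀ (u : ℝ → ℝ³ → ℝ³) (p : ℝ → ℝ³ → ℝ), InClassA C u →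
    Literature.Analysis.FluidPDE.IsClassicalNSSolutionOn (Set.Iio 0) 1 0 u p → NearFarPressure c₀ C u p →
    LocalEnergyBound K u

/-- S3 — BLOW-DOWN CLOSURE WITH PERSISTENCE (known type, size L): for `u ∈ A_C ∩ 𝒦_K`, a centre
`(t₀,x₀)` with `t₀ < 0` and scales `kₙ → ∞`, every slice-wise locally uniform limit `U` of the
blow-downs `kₙ u(t₀ + kₙ²t, x₀ + kₙx)` lies again in `A_C ∩ 𝒦_K` (same constants: scale/translation
invariance, closure of the Oseen identity by dominated convergence, KNSS smoothing, lower
semicontinuity), and if `u(t₀,x₀) ≠ 0` the space–time origin is a BACKWARD-SINGULAR point of `U`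
(`‖kₙu‖_{L∞(Q_R)} ≥ kₙ|u(t₀,x₀)| → ∞`; Albritton–Barker 2019 Lemma 2.2 + Prop. 2.3 = Lin 1998 /
Rusin–Šverák 2011, tree theorems `SuitableCompactness_holds`, `PersistenceOfSingularities_holds`; the
uniform `L³(Q₁)`/`L^{3/2}` bounds they need are exactly `𝒦_K` + Type I + the KNSS pressure). -/
def BlowDownClosure : Prop :=
  ∀ (C K : ℝ) (u : ℝ → ℝ³ → ℝ³) (t₀ : ℝ) (x₀ : ℝ³) (k : ℕ → ℝ) (U : ℝ → ℝ³ → ℝ³),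
    InClassA C u → LocalEnergyBound K u → t₀ < 0 → (∀ n, 0 < k n) → Tendsto k atTop atTop →
    (∀ t < 0, TendstoLocallyUniformly (fun (n : ℕ) (x : ℝ³) => k n • u (t₀ + k n ^ 2 * t) (x₀ + k n • x))
      (U t) atTop) →
    InClassA C U ∧ LocalEnergyBound K U ∧
      (u t₀ x₀ ≠ 0 → Literature.Analysis.FluidPDE.IsBackwardSingularPoint U 0)

/-- S4 — ASYMPTOTIC SPIRAL SELF-SIMILARITY (OPEN — hardest, load-bearing): for `u ∈ A_C ∩ 𝒦_K` and
every centre `(t₀,x₀)`, `t₀ < 0`, SOME blow-down sequence converges slice-wise locally uniformly to a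
field `U` annihilated by the generator of a one-parameter group of scalings∘rotations about the
origin, `L_(0,1,A) U = ∇U·(x + Ax) + U + 2t ∂ₜU − AU ≡ 0` (`A` skew). The Navier–Stokes analogue of
Giga–Kohn / Huisken / Enders–Müller–Topping "Type I ⇒ self-similar tangent flow"; implied by X (only
`u = 0`), and together with S1–S3, S5, S6 it implies X. -/
def AsymptoticSpiralSelfSimilarity : Prop :=
  ∀ (C K : ℝ) (u : ℝ → ℝ³ → ℝ³) (t₀ : ℝ) (x₀ : ℝ³), InClassA C u → LocalEnergyBound K u → t₀ < 0 →
    ∃ (k : ℕ → ℝ) (U : ℝ → ℝ³ → ℝ³) (A : ℝ³ →L[ℝ] ℝ³), (∀ n, 0 < k n) ∧ Tendsto k atTop atTop ∧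
      (∀ t < 0, TendstoLocallyUniformly (fun (n : ℕ) (x : ℝ³) => k n • u (t₀ + k n ^ 2 * t) (x₀ + k n • x))
        (U t) atTop) ∧
      (∀ x, inner ℝ (A x) x = 0) ∧
      ∀ t < 0, ∀ x, fderiv ℝ (U t) x (x + A x) + U t x +
        (2 * t) • Literature.Analysis.FluidPDE.timeDeriv U t x - A (U t x) = 0

/-- S5 — THE SELF-SIMILAR LEAF (known, size M): an element of `A_C` annihilated by the pure scaling
generator `x·∇U + U + 2t∂ₜU` vanishes. Euler homogeneity along the scaling flow ⇒
`U(t,x) = (−t)^{-1/2} 𝒰(x/√(−t))` with `𝒰 = U(−1,·)` bounded by `C`; the classical pair at the slice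
`t = −1` makes `(𝒰, P(−1,·))` a Leray profile with `a = ½` (`IsLerayProfile 1 (1/2)`); Tsai 1998
Thm 1 (`q = ∞`, tree theorem `tsai_selfsimilar_bounded_holds`) ⇒ `𝒰 ≡ c` ⇒ slices constant ⇒ `0`
(`IsTypeIAncientMild.eq_zero_of_slice_const`). -/
def SelfSimilarLeafVanishes : Prop :=
  ∀ (C : ℝ) (U : ℝ → ℝ³ → ℝ³), InClassA C U →
    (∀ t < 0, ∀ x, fderiv ℝ (U t) x x + U t x + (2 * t) • Literature.Analysis.FluidPDE.timeDeriv U t x = 0) →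
    ∀ t < 0, ∀ x, U t x = 0

/-- S6 — THE ROTATED SELF-SIMILAR LEAF INSIDE 𝒦 (OPEN): an element of `A_C ∩ 𝒦_K` annihilated by
`L_(0,1,A)` with `A ≠ 0` skew (rotated self-similar about the origin, BOUNDED profile with LERAY-RATE
energy growth `∫_{B_M}|𝒰|² ≤ K M`) vanishes. The RSS leaf of `SymmetricLiouville` (stmt-4053) weakened by
the ledger's averaged decay; Pineau–Vicol 2026 (arXiv:2607.09619) Thm 1.4 proves it for pointwise
decaying profiles with `|α| ≪ 1` or `≫ 1`; `α ≈ 1` is their Conjecture 1.1 = Tsai 2018 Conj. 8.9. -/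
def RotatedSelfSimilarLeafVanishesInK : Prop :=
  ∀ (C K : ℝ) (U : ℝ → ℝ³ → ℝ³) (A : ℝ³ →L[ℝ] ℝ³), InClassA C U → LocalEnergyBound K U →
    (∀ x, inner ℝ (A x) x = 0) → A ≠ 0 →
    (∀ t < 0, ∀ x, fderiv ℝ (U t) x (x + A x) + U t x +
      (2 * t) • Literature.Analysis.FluidPDE.timeDeriv U t x - A (U t x) = 0) →
    ∀ t < 0, ∀ x, U t x = 0

/-- Readable alias of the crux, used as the conclusion of the statement-level composition theorem so
that `ForcedSymmetry_of` is the only theorem of this file concluding the crux by name. -/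
def Crux : Prop :=
  Summit.NavierStokesRegularity.NavierStokesRegularity.Theses.SymmetryModuliCount.ForcedSymmetry

/-! ## Registered stubs (signatures over tree declarations only) -/

/-- stub S1 `KNSSPressure` (known type, L): the KNSS pressure of a Type-I mild ancient field is a
classical pressure with the near/far Calderón–Zygmund structure. Sources: KNSS2009 §2 (2.4)–(2.8)
(arXiv:0709.3599); Seregin2014Notes Def. 6.3, Prop. 3.9; Stein 1970 Ch. II–III; tree
`TypeIAncientMildClassical.lean`, `SingularIntegrals/CalderonZygmundLp.lean`,
`NecasRuzickaSverakPressure.lean` (`nrs1996_rieszPressure` pattern). -/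
theorem stub_knssPressure :
    ∃ c₀ : ℝ, ∀ (C : ℝ) (u : ℝ → EuclideanSpace ℝ (Fin 3) → EuclideanSpace ℝ (Fin 3)), ContDiffOn ℝ
    (⊤ : ℕ∞) (Function.uncurry u) (Set.Iio 0 ×ˢ Set.univ) ∧ (∀ t < 0,
    Literature.Analysis.FluidPDE.VectorCalculus.IsDivFree (u t)) ∧ (∀ s t : ℝ, s < t → t < 0 → ∀ x, u t
    x = Literature.Analysis.FluidPDE.heatFlow (u s) (t - s) x - ∫ τ in Set.Ioo s t, ∫ y,
    Literature.Analysis.FluidPDE.oseenKernel (t - τ) (x - y) (u τ y) (u τ y)) ∧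
    Literature.Analysis.FluidPDE.HasTypeITimeDecay C u → ∃ p : ℝ → EuclideanSpace ℝ (Fin 3) → ℝ,
    Literature.Analysis.FluidPDE.IsClassicalNSSolutionOn (Set.Iio 0) 1 0 u p ∧ (∀ t < 0, ∀ (x₀ :
    EuclideanSpace ℝ (Fin 3)) (R : ℝ), 0 < R → ∃ (c : ℝ) (p₁ p₂ : EuclideanSpace ℝ (Fin 3) → ℝ), (∀ x
    ∈ Metric.ball x₀ (2 * R), p t x = c + p₁ x + p₂ x) ∧ MeasureTheory.MemLp p₁ 2
    MeasureTheory.volume ∧ (∫ x, p₁ x ^ 2) ≤ c₀ * (C ^ 2 / (-t)) * ∫ x in Metric.ball x₀ (4 * R), ‖u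
    t x‖ ^ 2 ∧ (∀ x ∈ Metric.ball x₀ (2 * R), DifferentiableAt ℝ p₂ x ∧ ‖fderiv ℝ p₂ x‖ ≤ c₀ * ∫ y
    in (Metric.ball x₀ (4 * R))ᶜ, ‖u t y‖ ^ 2 / ‖y - x₀‖ ^ 4)) := by
  sorry

/-- stub S2 `FarPastLedger` (NEW — the card's lemma, M–L): temporal Type I + KNSS gauge ⇒ bounded
scale-invariant local energies on ALL backward cylinders with top `t₀ ≤ 0` (`A_C ⊂ 𝒦_{K(C,c₀)}`),
via the far-past local energy balance and the exponent bootstrap `3 → 2 → 1`. Sources: the idea card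
+ `Ideator1Notes.md §A` (constants), triage r1-1/2/3 (independent recomputations); AlbrittonBarker2019
Rem. 3.2 (arXiv:1811.00502 p. 7: the implication left open); Seregin2014Notes Prop. 3.9 Step 1–2
(unit-scale version); CKN 1982 §2 (local energy identity). -/
theorem stub_farPastLedger :
    ∀ (C c₀ : ℝ), ∃ K : ℝ, ∀ (u : ℝ → EuclideanSpace ℝ (Fin 3) → EuclideanSpace ℝ (Fin 3)) (p : ℝ →
    EuclideanSpace ℝ (Fin 3) → ℝ), ContDiffOn ℝ (⊤ : ℕ∞) (Function.uncurry u) (Set.Iio 0 ×ˢ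
    Set.univ) ∧ (∀ t < 0, Literature.Analysis.FluidPDE.VectorCalculus.IsDivFree (u t)) ∧ (∀ s t : ℝ,
    s < t → t < 0 → ∀ x, u t x = Literature.Analysis.FluidPDE.heatFlow (u s) (t - s) x - ∫ τ in
    Set.Ioo s t, ∫ y, Literature.Analysis.FluidPDE.oseenKernel (t - τ) (x - y) (u τ y) (u τ y)) ∧
    Literature.Analysis.FluidPDE.HasTypeITimeDecay C u →
    Literature.Analysis.FluidPDE.IsClassicalNSSolutionOn (Set.Iio 0) 1 0 u p → (∀ t < 0, ∀ (x₀ :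
    EuclideanSpace ℝ (Fin 3)) (R : ℝ), 0 < R → ∃ (c : ℝ) (p₁ p₂ : EuclideanSpace ℝ (Fin 3) → ℝ), (∀ x
    ∈ Metric.ball x₀ (2 * R), p t x = c + p₁ x + p₂ x) ∧ MeasureTheory.MemLp p₁ 2
    MeasureTheory.volume ∧ (∫ x, p₁ x ^ 2) ≤ c₀ * (C ^ 2 / (-t)) * ∫ x in Metric.ball x₀ (4 * R), ‖u
    t x‖ ^ 2 ∧ (∀ x ∈ Metric.ball x₀ (2 * R), DifferentiableAt ℝ p₂ x ∧ ‖fderiv ℝ p₂ x‖ ≤ c₀ * ∫ y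
    in (Metric.ball x₀ (4 * R))ᶜ, ‖u t y‖ ^ 2 / ‖y - x₀‖ ^ 4)) → ∀ (x₀ : EuclideanSpace ℝ (Fin 3))
    (t₀ r : ℝ), t₀ ≤ 0 → 0 < r → (∀ t, t₀ - r ^ 2 < t → t < t₀ → r⁻¹ * ∫ x in Metric.ball x₀ r, ‖u t
    x‖ ^ 2 ≤ K) ∧ r⁻¹ * ∫ t in Set.Ioo (t₀ - r ^ 2) t₀, ∫ x in Metric.ball x₀ r, ‖fderiv ℝ (u t) x‖
    ^ 2 ≤ K := by
  sorry

/-- stub S3 `BlowDownClosure` (known type, L): blow-down limits of `A_C ∩ 𝒦_K` stay in `A_C ∩ 𝒦_K`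
and are backward-singular at the origin when the centre is a nonzero point. Sources: AlbrittonBarker2019
Lemma 2.2, Prop. 2.3 and the proof of Thm 1.1 (reverse direction, p. 7); Lin 1998 Thm 2.2; RusinSverak2011
Lemmas 2.1–2.2; KNSS2009 Prop. 4.1 (tree `knss2009_smoothing_holds`); tree `SuitableCompactness_holds`,
`PersistenceOfSingularities_holds`, `IsBackwardSingularPoint`. -/
theorem stub_blowDownClosure :
    ∀ (C K : ℝ) (u : ℝ → EuclideanSpace ℝ (Fin 3) → EuclideanSpace ℝ (Fin 3)) (t₀ : ℝ) (x₀ :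
    EuclideanSpace ℝ (Fin 3)) (k : ℕ → ℝ) (U : ℝ → EuclideanSpace ℝ (Fin 3) → EuclideanSpace ℝ (Fin
    3)), ContDiffOn ℝ (⊤ : ℕ∞) (Function.uncurry u) (Set.Iio 0 ×ˢ Set.univ) ∧ (∀ t < 0,
    Literature.Analysis.FluidPDE.VectorCalculus.IsDivFree (u t)) ∧ (∀ s t : ℝ, s < t → t < 0 → ∀ x, u t
    x = Literature.Analysis.FluidPDE.heatFlow (u s) (t - s) x - ∫ τ in Set.Ioo s t, ∫ y,
    Literature.Analysis.FluidPDE.oseenKernel (t - τ) (x - y) (u τ y) (u τ y)) ∧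
    Literature.Analysis.FluidPDE.HasTypeITimeDecay C u → (∀ (x₁ : EuclideanSpace ℝ (Fin 3)) (t₁ r :
    ℝ), t₁ ≤ 0 → 0 < r → (∀ t, t₁ - r ^ 2 < t → t < t₁ → r⁻¹ * ∫ x in Metric.ball x₁ r, ‖u t x‖ ^ 2 ≤
    K) ∧ r⁻¹ * ∫ t in Set.Ioo (t₁ - r ^ 2) t₁, ∫ x in Metric.ball x₁ r, ‖fderiv ℝ (u t) x‖ ^ 2 ≤ K)
    → t₀ < 0 → (∀ n, 0 < k n) → Filter.Tendsto k Filter.atTop Filter.atTop → (∀ t < 0,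
    TendstoLocallyUniformly (fun (n : ℕ) (x : EuclideanSpace ℝ (Fin 3)) => k n • u (t₀ + k n ^ 2 * t)
    (x₀ + k n • x)) (U t) Filter.atTop) → (ContDiffOn ℝ (⊤ : ℕ∞) (Function.uncurry U) (Set.Iio 0 ×ˢ
    Set.univ) ∧ (∀ t < 0, Literature.Analysis.FluidPDE.VectorCalculus.IsDivFree (U t)) ∧ (∀ s t : ℝ,
    s < t → t < 0 → ∀ x, U t x = Literature.Analysis.FluidPDE.heatFlow (U s) (t - s) x - ∫ τ in
    Set.Ioo s t, ∫ y, Literature.Analysis.FluidPDE.oseenKernel (t - τ) (x - y) (U τ y) (U τ y)) ∧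
    Literature.Analysis.FluidPDE.HasTypeITimeDecay C U) ∧ (∀ (x₁ : EuclideanSpace ℝ (Fin 3)) (t₁ r :
    ℝ), t₁ ≤ 0 → 0 < r → (∀ t, t₁ - r ^ 2 < t → t < t₁ → r⁻¹ * ∫ x in Metric.ball x₁ r, ‖U t x‖ ^ 2 ≤
    K) ∧ r⁻¹ * ∫ t in Set.Ioo (t₁ - r ^ 2) t₁, ∫ x in Metric.ball x₁ r, ‖fderiv ℝ (U t) x‖ ^ 2 ≤ K)
    ∧ (u t₀ x₀ ≠ 0 → Literature.Analysis.FluidPDE.IsBackwardSingularPoint U 0) := by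
  sorry

/-- stub S4 `AsymptoticSpiralSelfSimilarity` (OPEN — hardest, load-bearing): some blow-down limit of an
element of `A_C ∩ 𝒦_K` is spiral-self-similar about the origin. Sources (analogues and partial
results): GigaKohn1985 (CPAM 38; asymptotically self-similar blow-up of semilinear heat),
EndersMullerTopping2011 (arXiv:1005.1624, Type-I Ricci ⇒ shrinking-soliton blow-ups), Chae2007
(arXiv:math/0604234, Thm 1.5: asymptotically self-similar NS singularities are absent — the forward
pattern, tree `chae2007_asymptoticallySelfSimilar_local`), PineauVicol2026 (arXiv:2607.09619 Thm 1.9: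
approximately self-similar Type-I solutions are regular), KNSS2009 §6 / BradshawTsai2017CPDE OP 5.1
(what a counterexample would be: a symmetry-free or DSS backward profile). -/
theorem stub_asymptoticSpiralSelfSimilarity :
    ∀ (C K : ℝ) (u : ℝ → EuclideanSpace ℝ (Fin 3) → EuclideanSpace ℝ (Fin 3)) (t₀ : ℝ) (x₀ :
    EuclideanSpace ℝ (Fin 3)), ContDiffOn ℝ (⊤ : ℕ∞) (Function.uncurry u) (Set.Iio 0 ×ˢ Set.univ) ∧
    (∀ t < 0, Literature.Analysis.FluidPDE.VectorCalculus.IsDivFree (u t)) ∧ (∀ s t : ℝ, s < t → t < 0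
    → ∀ x, u t x = Literature.Analysis.FluidPDE.heatFlow (u s) (t - s) x - ∫ τ in Set.Ioo s t, ∫ y,
    Literature.Analysis.FluidPDE.oseenKernel (t - τ) (x - y) (u τ y) (u τ y)) ∧
    Literature.Analysis.FluidPDE.HasTypeITimeDecay C u → (∀ (x₁ : EuclideanSpace ℝ (Fin 3)) (t₁ r :
    ℝ), t₁ ≤ 0 → 0 < r → (∀ t, t₁ - r ^ 2 < t → t < t₁ → r⁻¹ * ∫ x in Metric.ball x₁ r, ‖u t x‖ ^ 2 ≤
    K) ∧ r⁻¹ * ∫ t in Set.Ioo (t₁ - r ^ 2) t₁, ∫ x in Metric.ball x₁ r, ‖fderiv ℝ (u t) x‖ ^ 2 ≤ K)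
    → t₀ < 0 → ∃ (k : ℕ → ℝ) (U : ℝ → EuclideanSpace ℝ (Fin 3) → EuclideanSpace ℝ (Fin 3)) (A :
    EuclideanSpace ℝ (Fin 3) →L[ℝ] EuclideanSpace ℝ (Fin 3)), (∀ n, 0 < k n) ∧ Filter.Tendsto k
    Filter.atTop Filter.atTop ∧ (∀ t < 0, TendstoLocallyUniformly (fun (n : ℕ) (x : EuclideanSpace ℝ
    (Fin 3)) => k n • u (t₀ + k n ^ 2 * t) (x₀ + k n • x)) (U t) Filter.atTop) ∧ (∀ x, inner ℝ (A x)
    x = 0) ∧ ∀ t < 0, ∀ x, fderiv ℝ (U t) x (x + A x) + U t x + (2 * t) •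
    Literature.Analysis.FluidPDE.timeDeriv U t x - A (U t x) = 0 := by
  sorry

/-- stub S5 `SelfSimilarLeafVanishes` (known, M): a self-similar element of `A_C` vanishes (Euler
homogeneity ⇒ bounded Leray profile with `a = ½` ⇒ constant by Tsai 1998 Thm 1, `q = ∞` ⇒ `0` in the
Oseen gauge). Sources: Tsai1998 Thm 1 (tree theorem `tsai_selfsimilar_bounded_holds`,
`IsLerayProfile.exists_eq_const_of_bounded`); KNSS2009 Remark 6.1 (tree
`IsTypeIAncientMild.eq_zero_of_slice_const`); Leray 1934 (3.11)–(3.12) (tree `lerayBackward`,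
`lerayBackward_isClassical_iff`). -/
theorem stub_selfSimilarLeafVanishes :
    ∀ (C : ℝ) (U : ℝ → EuclideanSpace ℝ (Fin 3) → EuclideanSpace ℝ (Fin 3)), ContDiffOn ℝ (⊤ : ℕ∞)
    (Function.uncurry U) (Set.Iio 0 ×ˢ Set.univ) ∧ (∀ t < 0,
    Literature.Analysis.FluidPDE.VectorCalculus.IsDivFree (U t)) ∧ (∀ s t : ℝ, s < t → t < 0 → ∀ x, U t
    x = Literature.Analysis.FluidPDE.heatFlow (U s) (t - s) x - ∫ τ in Set.Ioo s t, ∫ y,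
    Literature.Analysis.FluidPDE.oseenKernel (t - τ) (x - y) (U τ y) (U τ y)) ∧
    Literature.Analysis.FluidPDE.HasTypeITimeDecay C U → (∀ t < 0, ∀ x, fderiv ℝ (U t) x x + U t x + (2
    * t) • Literature.Analysis.FluidPDE.timeDeriv U t x = 0) → ∀ t < 0, ∀ x, U t x = 0 := by
  sorry

/-- stub S6 `RotatedSelfSimilarLeafVanishesInK` (OPEN): a rotated-self-similar element of `A_C ∩ 𝒦_K`
(bounded profile with Leray-rate energy growth, any rotation rate) vanishes. Sources: PineauVicol2026
arXiv:2607.09619 Thm 1.4 and Conj. 1.1; Tsai2018 Conj. 8.9; the sister crux's disprover file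
`Cruxes/SymmetricLiouville/Disproof.lean` (`RotatedSelfSimilarLiouville`, isolated as the residue). -/
theorem stub_rotatedSelfSimilarLeafVanishesInK :
    ∀ (C K : ℝ) (U : ℝ → EuclideanSpace ℝ (Fin 3) → EuclideanSpace ℝ (Fin 3)) (A : EuclideanSpace ℝ
    (Fin 3) →L[ℝ] EuclideanSpace ℝ (Fin 3)), ContDiffOn ℝ (⊤ : ℕ∞) (Function.uncurry U) (Set.Iio 0 ×ˢ
    Set.univ) ∧ (∀ t < 0, Literature.Analysis.FluidPDE.VectorCalculus.IsDivFree (U t)) ∧ (∀ s t : ℝ,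
    s < t → t < 0 → ∀ x, U t x = Literature.Analysis.FluidPDE.heatFlow (U s) (t - s) x - ∫ τ in
    Set.Ioo s t, ∫ y, Literature.Analysis.FluidPDE.oseenKernel (t - τ) (x - y) (U τ y) (U τ y)) ∧
    Literature.Analysis.FluidPDE.HasTypeITimeDecay C U → (∀ (x₁ : EuclideanSpace ℝ (Fin 3)) (t₁ r :
    ℝ), t₁ ≤ 0 → 0 < r → (∀ t, t₁ - r ^ 2 < t → t < t₁ → r⁻¹ * ∫ x in Metric.ball x₁ r, ‖U t x‖ ^ 2 ≤
    K) ∧ r⁻¹ * ∫ t in Set.Ioo (t₁ - r ^ 2) t₁, ∫ x in Metric.ball x₁ r, ‖fderiv ℝ (U t) x‖ ^ 2 ≤ K)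
    → (∀ x, inner ℝ (A x) x = 0) → A ≠ 0 → (∀ t < 0, ∀ x, fderiv ℝ (U t) x (x + A x) + U t x + (2 *
    t) • Literature.Analysis.FluidPDE.timeDeriv U t x - A (U t x) = 0) → ∀ t < 0, ∀ x, U t x = 0 := by
  sorry

/-! ## Composition (sorry-free) -/

/-- A field vanishing on `t < 0` has every similarity symmetry (here translation by `e₀`): the last
step `X → ForcedSymmetry` (`Disproof.lean §4`, `forcedSymmetry_of_typeIAncientLiouville`, re-proved). -/
theorem hasSimSymmetry_of_vanishes {u : ℝ → ℝ³ → ℝ³} (h : ∀ t < 0, ∀ x, u t x = 0) :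
    ∃ (a : ℝ³) (σ : ℝ) (A : ℝ³ →L[ℝ] ℝ³), (∀ x, inner ℝ (A x) x = 0) ∧ ¬ (a = 0 ∧ σ = 0 ∧ A = 0) ∧
      ∀ t < 0, ∀ x, fderiv ℝ (u t) x (a + σ • x + A x) + σ • u t x +
        (2 * σ * t) • Literature.Analysis.FluidPDE.timeDeriv u t x - A (u t x) = 0 := by
  refine ⟨EuclideanSpace.single (0 : Fin 3) (1 : ℝ), 0, 0, fun x => by simp, fun hh => ?_, fun t ht x => ?_⟩
  · have h1 := congrArg (fun v : ℝ³ => v 0) hh.1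
    simp at h1
  · have hut : u t = fun _ => 0 := funext (h t ht)
    simp [hut]

/-- A field vanishing on `t < 0` has no backward-singular point at the origin: it is (essentially)
bounded — indeed zero — on the backward cylinder `Q_1(0,0) ⊂ {t < 0}`. -/
theorem not_isBackwardSingularPoint_of_vanishes {U : ℝ → ℝ³ → ℝ³} (h : ∀ t < 0, ∀ x, U t x = 0) :
    ¬ Literature.Analysis.FluidPDE.IsBackwardSingularPoint U 0 := by
  intro hs
  have h1 := hs 1 one_pos
  have hQ : MeasurableSet (Literature.Analysis.FluidPDE.parabolicCylinder 1 (0 : ℝ × ℝ³)) :=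
    (Literature.Analysis.FluidPDE.isOpen_parabolicCylinder 1 _).measurableSet
  have hae : (Function.uncurry U) =ᵐ[volume.restrict
      (Literature.Analysis.FluidPDE.parabolicCylinder 1 (0 : ℝ × ℝ³))] 0 := by
    filter_upwards [ae_restrict_mem hQ] with w hw
    obtain ⟨t, x⟩ := w
    rw [Literature.Analysis.FluidPDE.mem_parabolicCylinder] at hw
    have ht : t < 0 := by simpa using hw.1.2
    simp [Function.uncurry, h t ht x]
  rw [eLpNorm_congr_ae hae, eLpNorm_zero] at h1
  exact ENNReal.zero_ne_top h1

/-- X = `TypeIAncientLiouville` (the route target, stmt-4050) from S1–S6: a nonzero `u ∈ A_C` is in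
`𝒦_K` (S1, S2); blow down at a nonzero point: S4 gives a spiral-self-similar limit `U`, S3 puts `U` in
`A_C ∩ 𝒦_K` with a backward-singular origin, S5/S6 force `U ≡ 0` on `t < 0` — contradiction. -/
theorem typeIAncientLiouville_of (h1 : KNSSPressure) (h2 : FarPastLedger) (h3 : BlowDownClosure)
    (h4 : AsymptoticSpiralSelfSimilarity) (h5 : SelfSimilarLeafVanishes)
    (h6 : RotatedSelfSimilarLeafVanishesInK) :
    Summit.NavierStokesRegularity.NavierStokesRegularity.Theses.SymmetryModuliCount.TypeIAncientLiouville := by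
  intro C u hu t₀ ht₀ x₀
  by_contra hne
  obtain ⟨c₀, hc₀⟩ := h1
  obtain ⟨K, hK⟩ := h2 C c₀
  obtain ⟨p, hcl, hnf⟩ := hc₀ C u hu
  have hH5 : LocalEnergyBound K u := hK u p hu hcl hnf
  obtain ⟨k, U, A, hkpos, hklim, hconv, hA, hSS⟩ := h4 C K u t₀ x₀ hu hH5 ht₀
  obtain ⟨hU, hU5, hsing⟩ := h3 C K u t₀ x₀ k U hu hH5 ht₀ hkpos hklim hconv
  have hU0 : ∀ t < 0, ∀ x, U t x = 0 := by
    by_cases hA0 : A = 0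
    · refine h5 C U hU ?_
      intro t ht x
      have e := hSS t ht x
      simpa [hA0] using e
    · exact h6 C K U A hU hU5 hA hA0 hSS
  exact not_isBackwardSingularPoint_of_vanishes hU0 (hsing hne)

/-- Statement-level composition: S1 → S2 → S3 → S4 → S5 → S6 → crux (`0` is symmetric). -/
theorem composition (h1 : KNSSPressure) (h2 : FarPastLedger) (h3 : BlowDownClosure)
    (h4 : AsymptoticSpiralSelfSimilarity) (h5 : SelfSimilarLeafVanishes)
    (h6 : RotatedSelfSimilarLeafVanishesInK) : Crux := by
  intro C u hu
  exact hasSimSymmetry_of_vanishes (typeIAncientLiouville_of h1 h2 h3 h4 h5 h6 C u hu)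

/-- THE SKELETON: the crux `SymmetryModuliCount.ForcedSymmetry` by name, from the six registered stubs
(sorries only inside `stub_*`). -/
theorem ForcedSymmetry_of :
    Summit.NavierStokesRegularity.NavierStokesRegularity.Theses.SymmetryModuliCount.ForcedSymmetry :=
  composition stub_knssPressure stub_farPastLedger stub_blowDownClosure
    stub_asymptoticSpiralSelfSimilarity stub_selfSimilarLeafVanishes stub_rotatedSelfSimilarLeafVanishesInK

end Summit.NavierStokesRegularity.NavierStokesRegularity.Cruxes.ForcedSymmetry.FarPastEnergyLedger
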